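/-
Copyright: the b2b-balaban cell (near-miss cell 7), T⁴-continuum fan-out, lineage t4-ne7b-p3 (node U5c LARGE-DEVIATION
member P3).  Released under the licence of the surrounding project.
-/
import Summits.QuantumFields.BalabanUV.T4Continuum.Support.SpaceTimePeierls
import Summits.QuantumFields.BalabanUV.T4Continuum.Support.SpaceTimePeierlsLeaves

/-!
# Space-time Peierls ∕ Cramér route for NE7b — the BRIDGE: occupancy-model leaves A1 ∧ A2c ∧ A3 ⇒ the kernel assembly

Summits-side support leaf of the T⁴-continuum cell (rung (B)+1 on a FINITE torus only; NOT infinite volume, NOT the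
mass gap, NOT the Clay statement; NOT a proof of the spine estimate NE7b).  Lineage `t4-ne7b-p3` (generation 1), node
U5c, skeleton `t4/skeletons/NE7b-t4-ne7b-p3.md` rows ST4 ∕ ST9 (glue).  [folklore] finite combinatorics over the
abstract carrier `SpaceTimePeierlsLeaves.OccModel`; nothing is quoted from print and nothing printed is asserted; no
`[cite:]` tag.

WHAT.  `SpaceTimePeierls.sum_bad_le_of_contours` / `exists_relWeightBound_of_peierls` consume ANONYMOUS contour data
(`Sh`, `Pin`, `sz` with a cover, a count and a pinned bound).  This file manufactures that data from the three NAMED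
leaves of the skeleton stated on an occupancy model `M : OccModel ι Cell` (`SpaceTimePeierlsLeaves`):
A1 `SiteAnimalBound Δ Δ₁` for a degree bound `Δ` of `M.Adj`, A2c `M.ContourCover Bad jlo K` (every bad term has a
contour meeting every scale of `[jlo, K]`), A3 `M.PinnedContourBound A (e^{−s₁}) nup`; the anchors are the cells of
scale `K` (`≤ Nanc` of them).  Shapes = (anchor, connected cell set through it of size `≥ K + 1 − jlo`), pinned class =
the terms having that set as a contour.
* §1 `sum_bad_le_of_occModel`: at one `(K, t)`, A1 ∧ A2c ∧ A3 ⇒ `Σ_{Bad} A ≤ Nanc·ϱ^{K+1−jlo}/(1−ϱ)·nup`,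
  `ϱ = Δ₁e^{−s₁}`.
* §2 `contourBound_of_occLeaves`: an occupancy model with the three leaves at every `(K, t)` from `K₀` on (the cell
  type may depend on `K`; `jlo = j⋆(K) ≤ K`) ⇒ `SpaceTimePeierls.ContourBound … (contourBudget Nanc ϱ j⋆) K₀`;
  `exists_relWeightBound_of_occLeaves`: two runs + `LowEnvelope` ×2 (the (B)-socket) + `c·K ≤ K − j⋆(K)` ⇒ NE7b's
  output shape `RelWeightBound` — the END of the route with the leaves BY NAME.
Every leaf is a displayed binder; nothing of Bałaban's is asserted.

HONEST DEPENDENCY (cell, verbatim): continuum YM on T⁴ ⇐ BetaPertH ∧ nine spine estimates (0/9 proved); BetaPertH ⇐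
(D1) ∧ (D4) ∧ CAP+tail; G-an2-4 gates asym, D1 and NE2/3/4.  This file changes none of it.
-/

open Finset

namespace Summit.QuantumFields.BalabanUV.T4Continuum.SpaceTimePeierls

open Literature.MathematicalPhysics.QuantumFieldTheory.Balaban1983to89
open T4WeightBudget T4StabilitySocket SpaceTimePeierlsLeaves

noncomputable section

/-! ## §1 One `(K, t)`: the occupancy-model leaves give the numerator bound -/

section OneStep

variable {ι : Type*} [DecidableEq ι] {Cell : Type} [Fintype Cell] [DecidableEq Cell]

/-- **A1 ∧ A2c ∧ A3 ⇒ THE NUMERATOR BOUND at one `(K, t)`.**  On an occupancy model `M` whose adjacency has degrees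
`≤ Δ`: the site-animal bound `SiteAnimalBound Δ Δ₁` (A1), at most `Nanc` cells of scale `K` (anchors), the contour
cover of the bad class over the window `[jlo, K]` with `jlo ≤ K` (A2c), the pinned-contour bound with price `e^{−s₁}`
and envelope `nup ≥ 0` (A3), nonnegative weights on `M.T` (I-2) and the survival condition `Δ₁·e^{−s₁} < 1` give
`Σ_{Bad} A ≤ Nanc · ϱ^{K+1−jlo}/(1−ϱ) · nup`. [folklore] -/
theorem sum_bad_le_of_occModel (M : OccModel ι Cell) [DecidableRel M.Adj.Adj] (A : ι → ℝ) (Bad : Finset ι)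
    {K jlo Δ : ℕ} {Nanc Δ₁ s₁ nup : ℝ} (hdeg : ∀ c, M.Adj.degree c ≤ Δ) (hanimal : SiteAnimalBound Δ Δ₁)
    (hanc : (((univ : Finset Cell).filter fun c => M.scale c = K).card : ℝ) ≤ Nanc) (hjlo : jlo ≤ K)
    (hcover : M.ContourCover Bad jlo K) (hpin : M.PinnedContourBound A (Real.exp (-s₁)) nup)
    (hA : ∀ τ ∈ M.T, 0 ≤ A τ) (hNanc : 0 ≤ Nanc) (hΔ₁ : 0 ≤ Δ₁) (hnup : 0 ≤ nup)
    (hϱ : Δ₁ * Real.exp (-s₁) < 1) :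
    ∑ τ ∈ Bad, A τ
      ≤ Nanc * ((Δ₁ * Real.exp (-s₁)) ^ (K + 1 - jlo) / (1 - Δ₁ * Real.exp (-s₁))) * nup := by
  classical
  -- the connectivity-with-size predicate of an animal through `a`
  let P : Cell → ℕ → Finset Cell → Prop := fun a n S => a ∈ S ∧ S.card = n ∧ (M.Adj.induce (S : Set Cell)).Connected
  -- shapes: (anchor of scale K, connected set through it of size ≥ m)
  let m : ℕ := K + 1 - jlo
  let Sh : Finset (Cell × Finset Cell) := univ.filter fun b =>
    M.scale b.1 = K ∧ b.1 ∈ b.2 ∧ (M.Adj.induce (b.2 : Set Cell)).Connected ∧ m ≤ b.2.card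
  let Pin : Cell × Finset Cell → Finset ι := fun b => M.T.filter fun τ => M.IsContour τ b.2
  let sz : Cell × Finset Cell → ℕ := fun b => b.2.card
  -- A1 in `Finset` form: the animals through `a` of size `n` number ≤ Δ₁^n
  have hanim : ∀ (a : Cell) (n : ℕ), (((univ : Finset (Finset Cell)).filter (P a n)).card : ℝ) ≤ Δ₁ ^ n := by
    intro a n
    have h := hanimal Cell M.Adj hdeg a n
    have hc : Nat.card {S : Finset Cell // a ∈ S ∧ S.card = n ∧ (M.Adj.induce (S : Set Cell)).Connected}
        = ((univ : Finset (Finset Cell)).filter (P a n)).card := by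
      rw [Nat.card_eq_fintype_card, Fintype.card_subtype]
    rw [hc] at h
    exact h
  refine sum_bad_le_of_contours Bad M.T A Sh Pin sz (m := m) hA (fun b _ => filter_subset _ _) ?_ ?_ ?_ ?_
    hNanc hΔ₁ hnup hϱ
  · -- cover (A2c): the contour of a bad term through a scale-`K` cell is a shape, and the term is pinned by it
    intro τ hτ
    obtain ⟨𝒦, hcont, hmeet⟩ := hcover.2 τ hτ
    obtain ⟨a, ha𝒦, haK⟩ := hmeet K (mem_Icc.2 ⟨hjlo, le_rfl⟩)
    have hsize : m ≤ 𝒦.card := M.card_ge_of_cover hmeet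
    refine mem_biUnion.2 ⟨(a, 𝒦), ?_, ?_⟩
    · exact mem_filter.2 ⟨mem_univ _, haK, ha𝒦, hcont.2.2.1, hsize⟩
    · exact mem_filter.2 ⟨hcover.1 hτ, hcont⟩
  · -- sizes
    intro b hb
    exact (mem_filter.1 hb).2.2.2.2
  · -- count (A1 summed over the anchors)
    intro n
    let Anc : Finset Cell := univ.filter fun c => M.scale c = K
    have hsub : Sh.filter (fun b => sz b = n)
        ⊆ Anc.biUnion fun a => ((univ : Finset (Finset Cell)).filter (P a n)).image fun S => (a, S) := by
      intro b hb
      obtain ⟨hb1, hb2⟩ := mem_filter.1 hb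
      obtain ⟨_, hK, hmem, hconn, _⟩ := mem_filter.1 hb1
      refine mem_biUnion.2 ⟨b.1, mem_filter.2 ⟨mem_univ _, hK⟩, mem_image.2 ⟨b.2, ?_, rfl⟩⟩
      exact mem_filter.2 ⟨mem_univ _, hmem, hb2, hconn⟩
    calc ((Sh.filter fun b => sz b = n).card : ℝ)
        ≤ ((Anc.biUnion fun a => ((univ : Finset (Finset Cell)).filter (P a n)).image fun S => (a, S)).card : ℝ) := by
          exact_mod_cast card_le_card hsub
      _ ≤ ∑ a ∈ Anc, ((((univ : Finset (Finset Cell)).filter (P a n)).image fun S => (a, S)).card : ℝ) := by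
          exact_mod_cast card_biUnion_le
      _ ≤ ∑ a ∈ Anc, (((univ : Finset (Finset Cell)).filter (P a n)).card : ℝ) := by
          refine sum_le_sum fun a _ => ?_
          exact_mod_cast card_image_le
      _ ≤ ∑ _a ∈ Anc, Δ₁ ^ n := sum_le_sum fun a _ => hanim a n
      _ = (Anc.card : ℝ) * Δ₁ ^ n := by rw [sum_const, nsmul_eq_mul]
      _ ≤ Nanc * Δ₁ ^ n := mul_le_mul_of_nonneg_right hanc (pow_nonneg hΔ₁ n)
  · -- pinned bound (A3)
    intro b _
    have := hpin b.2
    convert this using 2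

end OneStep

/-! ## §2 All `(K, t)`: the leaves by name ⇒ `ContourBound` ⇒ NE7b's output shape -/

section Family

variable {ι : Type*} [DecidableEq ι] {l₀ : ℝ} {T : ℕ → Finset ι} {A B : ℕ → ℝ → ι → ℝ}
  {Bad : ℕ → ℝ → Finset ι} {nup mup nlow mlow : ℕ → ℝ → ℝ} {C : ℝ} {K₀ : ℕ}

/-- NAMED SHAPE `OccLeaves T A Bad nup jstar Nanc Δ₁ s₁ K t` (ONE run, ONE `(K, t)`): SOME finite occupancy model on
the run's terms `T K` carries the three leaves of the skeleton at `(K, t)` — a degree bound `Δ` with the site-animal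
bound `SiteAnimalBound Δ Δ₁` (A1), at most `Nanc` cells of the final scale `K`, the contour cover of `Bad K t` over
`[j⋆(K), K]` (A2c), the pinned-contour bound with price `e^{−s₁}` and envelope `nup K t` (A3) — and nonnegative
weights (I-2).  The cell type is existential (it grows with `K`).  A hypothesis shape; nothing asserted. [folklore] -/
def OccLeaves (T : ℕ → Finset ι) (A : ℕ → ℝ → ι → ℝ) (Bad : ℕ → ℝ → Finset ι) (nup : ℕ → ℝ → ℝ)
    (jstar : ℕ → ℕ) (Nanc Δ₁ s₁ : ℝ) (K : ℕ) (t : ℝ) : Prop :=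
  ∃ (Cell : Type) (_ : Fintype Cell) (_ : DecidableEq Cell) (M : OccModel ι Cell) (_ : DecidableRel M.Adj.Adj)
    (Δ : ℕ), M.T = T K ∧ (∀ c, M.Adj.degree c ≤ Δ) ∧ SiteAnimalBound Δ Δ₁ ∧
      (((univ : Finset Cell).filter fun c => M.scale c = K).card : ℝ) ≤ Nanc ∧
      M.ContourCover (Bad K t) (jstar K) K ∧ M.PinnedContourBound (A K t) (Real.exp (-s₁)) (nup K t) ∧
      ∀ τ ∈ T K, 0 ≤ A K t τ

/-- **THE LEAVES BY NAME ⇒ `ContourBound`** (one run): `OccLeaves` at every `(K, t)` from `K₀` on, `j⋆(K) ≤ K`,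
`nup ≥ 0`, `0 ≤ Nanc`, `0 ≤ Δ₁`, `Δ₁·e^{−s₁} < 1` ⇒ `ContourBound l₀ T A Bad nup (contourBudget Nanc ϱ j⋆) K₀`.
[folklore] -/
theorem contourBound_of_occLeaves {jstar : ℕ → ℕ} {Nanc Δ₁ s₁ : ℝ}
    (h : ∀ K t, |t| ≤ l₀ → K₀ ≤ K → OccLeaves T A Bad nup jstar Nanc Δ₁ s₁ K t) (hj : ∀ K, jstar K ≤ K)
    (hnup : ∀ K t, |t| ≤ l₀ → K₀ ≤ K → 0 ≤ nup K t) (hNanc : 0 ≤ Nanc) (hΔ₁ : 0 ≤ Δ₁)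
    (hϱ : Δ₁ * Real.exp (-s₁) < 1) :
    ContourBound l₀ T A Bad nup (contourBudget Nanc (Δ₁ * Real.exp (-s₁)) jstar) K₀ where
  bad_subset K t ht hK := by
    obtain ⟨Cell, _, _, M, _, Δ, hT, -, -, -, hcov, -, -⟩ := h K t ht hK
    rw [← hT]; exact hcov.1
  num K t ht hK := by
    obtain ⟨Cell, _, _, M, _, Δ, hT, hdeg, hanimal, hanc, hcov, hpin, hA⟩ := h K t ht hK
    have hm : K + 1 - jstar K = K - jstar K + 1 := by have := hj K; omega
    have key := sum_bad_le_of_occModel M (A K t) (Bad K t) hdeg hanimal hanc (hj K) hcov hpin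
      (by rw [hT]; exact hA) hNanc hΔ₁ (hnup K t ht hK) hϱ
    rw [hm] at key
    simpa only [contourBudget] using key

/-- **THE END OF THE ROUTE WITH THE LEAVES BY NAME** (skeleton §2 A1–A5, two runs): `OccLeaves` for run A and run B
at every `(K, t)` from `K₀` on (A1 ∧ A2c ∧ A3 ∧ I-2 on an occupancy model of each run), the denominators
`LowEnvelope` with a common constant (A4, from the pinned (B) by the socket), `j⋆(K) ≤ K`, the matching-scale fraction
`c·K ≤ K − j⋆(K)` (I-1), and the survival condition `Δ₁·e^{−s₁} < 1` give NE7b's output shape `RelWeightBound` with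
the bad classes emptied below some `K₁ ≥ K₀` and `W = 𝟙_{K ≥ K₁}·C·Nanc·ϱ^{K−j⋆(K)+1}/(1−ϱ)`.  Every leaf is a
displayed binder; nothing of Bałaban's is asserted. [folklore] -/
theorem exists_relWeightBound_of_occLeaves {jstar : ℕ → ℕ} {Nanc Δ₁ s₁ c : ℝ}
    (hAl : ∀ K t, |t| ≤ l₀ → K₀ ≤ K → OccLeaves T A Bad nup jstar Nanc Δ₁ s₁ K t)
    (hBl : ∀ K t, |t| ≤ l₀ → K₀ ≤ K → OccLeaves T B Bad mup jstar Nanc Δ₁ s₁ K t)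
    (hEA : LowEnvelope l₀ T A nlow nup C K₀) (hEB : LowEnvelope l₀ T B mlow mup C K₀) (hC : 0 ≤ C)
    (hj : ∀ K, jstar K ≤ K) (hNanc : 0 ≤ Nanc) (hΔ₁ : 0 < Δ₁) (hϱ : Δ₁ * Real.exp (-s₁) < 1) (hc : 0 < c)
    (hfrac : ∀ K : ℕ, c * K ≤ ((K - jstar K : ℕ) : ℝ)) :
    ∃ K₁, K₀ ≤ K₁ ∧ RelWeightBound l₀ T A B (fun K t => if K₁ ≤ K then Bad K t else ∅)
      (Set.indicator {K | K₁ ≤ K} (fun K => C * contourBudget Nanc (Δ₁ * Real.exp (-s₁)) jstar K)) := by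
  have hϱ0 : 0 < Δ₁ * Real.exp (-s₁) := mul_pos hΔ₁ (Real.exp_pos _)
  exact exists_relWeightBound_of_contourBound
    (contourBound_of_occLeaves hAl hj (fun K t ht hK => hEA.nup_nonneg K t ht hK) hNanc hΔ₁.le hϱ)
    (contourBound_of_occLeaves hBl hj (fun K t ht hK => hEB.nup_nonneg K t ht hK) hNanc hΔ₁.le hϱ)
    hEA hEB hC (contourBudget_nonneg hNanc hϱ0.le hϱ jstar) (summable_contourBudget hNanc hϱ0 hϱ hc hfrac)

end Family

end

end Summit.QuantumFields.BalabanUV.T4Continuum.SpaceTimePeierls
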